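/-
Origin: expansion seat `prover-pub-hodgecm-mc-binder-2-g11-0`, handover #30 r2 2026-08-20T02:48Z md5 bfdaceadecb7 (202 l.; CERTIFIED rc 0 / 0 warn / 169 s; SUPERSEDES g10 6222988d3e24 (never compiled): opens `GelbartRogawski1991(.UnitaryDualPair)`, `Adelic.adelicUnitaryGroup`, `include hηc in`, typed `let ρU`, the #28 block lemmas passed to `simp` with the explicit place `b` (their RHS depends on `b`), and the span extension done INLINE by `Submodule.span_induction` (the generic #24 `tendsto_slope_of_span` cannot be instantiated at Weil's `ThetaTop`: its `Module` instance sits over the type synonym — an instance-transparency diamond); content: `toThetaTopₗ`, **`curveOf`** (field `e`), `curveOf_zero` (`e_zero`), **`tendsto_toThetaTop_curveOf_ins_sub_div`** (field `smooth` in value currency for EVERY printed vector); axioms trio) (`HOME/mc/pub-hodgecm-mc-binder-2/g11/pkg/HodgeCM/Model/HypCensus/SmoothIns.lean`, md5 bfdaceadecb7, 202 lines);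
landed by the gen-14 packager (p-g14) in gate run 39 as `HodgeCM/Model/HypCensus/SmoothIns.lean` (verbatim).
-/
/-
Origin: speedrun cell pub-hodgecm, MODEL-CONSTRUCTION sub-cell, lineage mc-binder-2 (BINDER-OWNERS rows 18/19: E binders
`hyp12` / `hyp34` of `Model.perL_picardCM_r15A`), seat prover-pub-hodgecm-mc-binder-2-g10-0 (gen 10), 2026-08-19; r2 binder-2-g11 (opens/qualifications only).
Target in PKG: `HodgeCM/Model/HypCensus/SmoothIns.lean` (NEW additive leaf; imports this lineage's `HypCensus/SmoothW` (#26),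
`HypCensus/Ins` (#27), `HypCensus/ThetaTopLinear` (#24) and `HypCensus/SmoothBlockSlotNeg` (#11)).  KERNEL ONLY: 0 records,
nothing cited, 0 `def … : Prop`; two small linear-map packagings, one data def (`curveOf`) + theorems.
-/
import Summits.HodgeConjecture.HodgeCM.Model.HypCensus.SmoothW
import Summits.HodgeConjecture.HodgeCM.Model.HypCensus.Ins
import Summits.HodgeConjecture.HodgeCM.Model.HypCensus.ThetaTopLinear
import Summits.HodgeConjecture.HodgeCM.Model.HypCensus.SmoothBlockSlotNeg

/-!
# Census kit (rows A12/A34): the fields `e`, `e_zero`, `smooth` of the W-instance, CLOSED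

`HypCensus/SideW` (#22) states the census record `HypSideW W₀ jT kind lam hlam m₁ m₂` on a `wm` input `W₀`; for the W pin of
record `wmInputCM₂g …` (mc-unitary-1 `Model/WmInputInstance`, RUN 37) `W₀.eW = cmAdelicEquiv L 2 (diag (dW S))` definitionally and
`W₀.ρ = (cmPairRepTwist … hGR η).toHomUnits` under the sign fact (`wmInputCM₂g_ρ_eq_of`).  In that VALUE currency (model1 (R2): no
`wm` record in any statement; (R3): `η` generic) and with the census data of `HypCensus/Ins` (#27: `kind := kindOf datum`,
`lam := lamOf datum`, `ins := ins datum m₁ m₂`, any place data `datum`, any exponents `m₁ m₂`), this leaf DISCHARGES three of the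
six fields:

* `curveOf b u : ℝ → U(W)(𝔸)` — the field `e`: the `W`-boost curve (#26 `boostCurveW`) of the hyperbolic direction `u` at the place
  `b` (a direction exists only at a `Σ₁₂` place; its `W`-lines `r₀ u`, `s₀ u` are read off the datum); `curveOf_zero` — the field `e_zero`;
* **`tendsto_toThetaTop_curveOf_ins_sub_div`** — the field `smooth` (value currency, any rational set `Γ`):
  `s⁻¹ • (ρ_η(1, cmAdelicEquiv (e_b s)) (ins f φ) − ins f φ) ⟶ ins f (H^{(b)} φ)` in Weil's `Θ`-initial topology, `s → 0`, `s ≠ 0`,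
  for EVERY printed vector `φ ∈ ⨂_b 𝓕^{κ_b}_b` and every finite datum `f`.  Proof: on pure tensors it is #26
  `tendsto_toThetaTop_boostCurveW_sub_div` (the
  Folland–Konno–Konno slope through the tree's `Θ`-continuity of `Ψ ↦ E(Ψ ⊗ f)`) read through #27 `ins_tprod_eq_block` /
  `ins_hypX_tprod_eq_block` (the inserted pure tensor IS `F_v⁻¹(Φ₁ ⊠ Φ₂)` and its slot image IS `F_v⁻¹((hypOpWGen Φ₁) ⊠ Φ₂)` — LEMMA A,
  the printed hyperbolic operator at `λ_b = ∓π⁻¹` = Konno–Konno's boost generator), the slot's small datum being #8/#11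
  `exists_isArchWeilDatum_slot_of_definite` on the shape read off the datum (`PlaceDatum.slot_shape`); pure tensors SPAN
  (`PiTensorProduct.span_tprod_eq_top`) and slopes extend by linearity in a topological vector space (#24 `tendsto_slope_of_span`,
  `ThetaTop` has continuous `+`/`•`).

Hypotheses: `h₁W` (`W = ⟨a₀⟩ ⊕ ⟨a₁⟩` definite at `ι₁` — from `GoodCtx`, mc-unitary-1 `WGuard.dW_definite_of_thetaModel_goodCtx`),
`hηc` (continuity of `η`); the `V`-side sign facts are READ OFF `HermSpace3` inside #26.  At the pin the three fields of
`HypSideW (wmInputCM₂g … ) …` follow by `rw [wmInputCM₂g_ρ_eq_of … hW]` (successor leaf over the RUN-37 `Model/WmInputInstance`).  Nothing here is a claim of PerL/QW8.  Style lint (L-notation): no `local notation`.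
-/

set_option autoImplicit false

noncomputable section

open Filter Topology
open NumberField NumberField.InfinitePlace
open scoped TensorProduct Classical
open Literature.NumberTheory.Automorphic Literature.NumberTheory.Automorphic.UnitaryGroup Literature.NumberTheory.Weil1964
open Literature.RepresentationTheory.KonnoKonno2007 Literature.RepresentationTheory.KonnoKonno2007.RealDualPair
open Literature.NumberTheory.GelbartRogawski1991 Literature.NumberTheory.GelbartRogawski1991.UnitaryDualPair
open Literature.Analysis.SegalBargmann
open HodgeCM HodgeCM.Model HodgeCM.Adelic
open HodgeCM.PerL34.Fock HodgeCM.PerL34.Fock.PrintDict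

namespace HodgeCM.Model.HypCensus

/-! ## §1 Weil's `toThetaTop` as a linear map -/

section TopLinear

variable {F : Type} [Field F] [NumberField F] {ι : Type} [Fintype ι] {G : Type*} [Group G]
  (ρ : G →* (Module.End ℂ ↥(piSchwartzBruhat F ι))ˣ) (Γ : Set G)

/-- Weil's `toThetaTop` (the identity onto `ThetaTop`) as a `ℂ`-linear map. -/
def toThetaTopₗ : ↥(piSchwartzBruhat F ι) →ₗ[ℂ] (repWeilThetaDatum F ι ρ Γ).ThetaTop where
  toFun := (repWeilThetaDatum F ι ρ Γ).toThetaTop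
  map_add' _ _ := rfl
  map_smul' _ _ := rfl

/-- (Ported verbatim from the HodgeCMPerL package; no docstring in the source.) -/
@[simp] theorem toThetaTopₗ_apply (Φ : ↥(piSchwartzBruhat F ι)) :
    toThetaTopₗ ρ Γ Φ = (repWeilThetaDatum F ι ρ Γ).toThetaTop Φ := rfl

end TopLinear

/-! ## §2 The fields `e`, `e_zero`, `smooth` -/

section WInput

variable {L : CMField} {ι₁ : L →+* ℂ} (V : HermSpace3 L ι₁) (S : StubTree.SeesawDatum L)
variable
  (hGR : (cmSplittingDatum (L : Type) finProdFinEquiv (frameD V) (frameD_real V) (frameD_ne V) (dW S) (dW_real S) (dW_ne S)).CompatibleSplitting)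
  (η : CMAdelic (L : Type) (frameD V) × CMAdelic (L : Type) (dW S) →* ℂˣ)
  (hηc : Continuous fun p => ((η p : ℂˣ) : ℂ))
  (Γ : Set (CMAdelic (L : Type) (frameD V) × CMAdelic (L : Type) (dW S)))
variable (datum : ∀ b : InfinitePlace (L : Type),
  PlaceDatum (L : Type) (frameD V) (frameD_real V) (dW S) (dW_real S) ι₁ (cmPlacesEquiv (L : Type) b))
variable (m₁ m₂ : InfinitePlace (L : Type) → ℤ)

/-- **the curves of the census** (field `e`): the `W`-boost curve of the hyperbolic direction `u` at the place `b`, in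
`U(W)(𝔸) = adelicUnitaryGroup L S.gramW` (a direction exists only at a `Σ₁₂` place). -/
def curveOf (b : InfinitePlace (L : Type))
    (u : HypIdx (kindOf (L : Type) (frameD V) (frameD_real V) (dW S) (dW_real S) ι₁ datum b)) :
    ℝ → ↥(Adelic.adelicUnitaryGroup L S.gramW) :=
  boostCurveW V S (cmPlacesEquiv (L : Type) b) (Equiv.refl _) (Equiv.refl _) (Equiv.refl _) (Equiv.refl _)
    ((datum b).r₀ u) ((datum b).s₀ u)

/-- field `e_zero`: the curves pass through `1` at `s = 0`. -/
theorem curveOf_zero (b : InfinitePlace (L : Type))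
    (u : HypIdx (kindOf (L : Type) (frameD V) (frameD_real V) (dW S) (dW_real S) ι₁ datum b)) :
    curveOf V S datum b u 0 = 1 :=
  boostCurveW_zero V S _ _ _ _ _ _ _

include hηc in
/-- **field `smooth`, value currency, CLOSED**: along the boost curve of the direction `u` at `b`, every inserted printed vector is a
`C¹` vector of `ρ_η = cmPairRepTwist … hGR η` in Weil's `Θ`-initial topology (any rational set `Γ`), with derivative the inserted slot
image `ins f (H^{(b)} φ)`. -/
theorem tendsto_toThetaTop_curveOf_ins_sub_div
    (h₁W : (∀ j, 0 < (ι₁ ((dW S) j)).re) ∨ ∀ j, (ι₁ ((dW S) j)).re < 0)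
    (b : InfinitePlace (L : Type)) (u : HypIdx (kindOf (L : Type) (frameD V) (frameD_real V) (dW S) (dW_real S) ι₁ datum b))
    (f : FinSB ↥(maximalRealSubfield L) (Fin 6))
    (φ : (printPlaces (InfinitePlace (L : Type)) (kindOf (L : Type) (frameD V) (frameD_real V) (dW S) (dW_real S) ι₁ datum)
      (lamOf (L : Type) (frameD V) (frameD_real V) (dW S) (dW_real S) ι₁ datum)
      (lamOf_ne_zero (L : Type) (frameD V) (frameD_real V) (dW S) (dW_real S) ι₁ datum)
      (pinnedVacs (kindOf (L : Type) (frameD V) (frameD_real V) (dW S) (dW_real S) ι₁ datum) m₁ m₂)).F) :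
    Tendsto (fun s : ℝ => ((s : ℝ) : ℂ)⁻¹ •
        ((repWeilThetaDatum (↥(maximalRealSubfield L)) (Fin 6)
              (cmPairRepTwist (L : Type) finProdFinEquiv (frameD V) (frameD_real V) (frameD_ne V) (dW S) (dW_real S) (dW_ne S)
                hGR η).toHomUnits Γ).toThetaTop
            (cmPairRepTwist (L : Type) finProdFinEquiv (frameD V) (frameD_real V) (frameD_ne V) (dW S) (dW_real S) (dW_ne S) hGR η
              ((1 : CMAdelic (L : Type) (frameD V)),
                (cmAdelicEquiv (L : Type) 2 (Matrix.diagonal (dW S)) (curveOf V S datum b u s) : CMAdelic (L : Type) (dW S)))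
              (ins (L : Type) (frameD V) (frameD_real V) (frameD_ne V) (dW S) (dW_real S) (dW_ne S) ι₁ datum m₁ m₂ f φ)) -
          (repWeilThetaDatum (↥(maximalRealSubfield L)) (Fin 6)
              (cmPairRepTwist (L : Type) finProdFinEquiv (frameD V) (frameD_real V) (frameD_ne V) (dW S) (dW_real S) (dW_ne S)
                hGR η).toHomUnits Γ).toThetaTop
            (ins (L : Type) (frameD V) (frameD_real V) (frameD_ne V) (dW S) (dW_real S) (dW_ne S) ι₁ datum m₁ m₂ f φ)))
      (𝓝[≠] 0)
      (𝓝 ((repWeilThetaDatum (↥(maximalRealSubfield L)) (Fin 6)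
              (cmPairRepTwist (L : Type) finProdFinEquiv (frameD V) (frameD_real V) (frameD_ne V) (dW S) (dW_real S) (dW_ne S)
                hGR η).toHomUnits Γ).toThetaTop
        (ins (L : Type) (frameD V) (frameD_real V) (frameD_ne V) (dW S) (dW_real S) (dW_ne S) ι₁ datum m₁ m₂ f
          (hypX (InfinitePlace (L : Type)) (kindOf (L : Type) (frameD V) (frameD_real V) (dW S) (dW_real S) ι₁ datum)
            (lamOf (L : Type) (frameD V) (frameD_real V) (dW S) (dW_real S) ι₁ datum)
            (lamOf_ne_zero (L : Type) (frameD V) (frameD_real V) (dW S) (dW_real S) ι₁ datum)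
            (pinnedVacs (kindOf (L : Type) (frameD V) (frameD_real V) (dW S) (dW_real S) ι₁ datum) m₁ m₂) ⟨b, u⟩ φ)))) := by
  -- the three linear maps of #24 `tendsto_slope_of_span`
  let ρU : CMAdelic (L : Type) (frameD V) × CMAdelic (L : Type) (dW S) →*
      (Module.End ℂ ↥(piSchwartzBruhat ↥(maximalRealSubfield L) (Fin 6)))ˣ :=
    (cmPairRepTwist (L : Type) finProdFinEquiv (frameD V) (frameD_real V) (frameD_ne V) (dW S) (dW_real S) (dW_ne S)
      hGR η).toHomUnits
  let Tℓ := toThetaTopₗ ρU Γ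
  let R : ℝ → (↥(piSchwartzBruhat ↥(maximalRealSubfield L) (Fin 6)) →ₗ[ℂ] ↥(piSchwartzBruhat ↥(maximalRealSubfield L) (Fin 6))) :=
    fun s => cmPairRepTwist (L : Type) finProdFinEquiv (frameD V) (frameD_real V) (frameD_ne V) (dW S) (dW_real S) (dW_ne S) hGR η
      ((1 : CMAdelic (L : Type) (frameD V)),
        (cmAdelicEquiv (L : Type) 2 (Matrix.diagonal (dW S)) (curveOf V S datum b u s) : CMAdelic (L : Type) (dW S)))
  let I := ins (L : Type) (frameD V) (frameD_real V) (frameD_ne V) (dW S) (dW_real S) (dW_ne S) ι₁ datum m₁ m₂ f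
  let Hx := hypX (InfinitePlace (L : Type)) (kindOf (L : Type) (frameD V) (frameD_real V) (dW S) (dW_real S) ι₁ datum)
    (lamOf (L : Type) (frameD V) (frameD_real V) (dW S) (dW_real S) ι₁ datum)
    (lamOf_ne_zero (L : Type) (frameD V) (frameD_real V) (dW S) (dW_real S) ι₁ datum)
    (pinnedVacs (kindOf (L : Type) (frameD V) (frameD_real V) (dW S) (dW_real S) ι₁ datum) m₁ m₂) ⟨b, u⟩
  have key : ∀ g ∈ Set.range (PiTensorProduct.tprod ℂ),
      Tendsto (fun s : ℝ => ((s : ℝ) : ℂ)⁻¹ • ((Tℓ ∘ₗ R s ∘ₗ I) g - (Tℓ ∘ₗ I) g)) (𝓝[≠] 0) (𝓝 ((Tℓ ∘ₗ I ∘ₗ Hx) g)) := by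
    rintro _ ⟨m, rfl⟩
    obtain ⟨hR, hS, hV⟩ := (datum b).slot_shape u
    haveI := hR
    haveI := hS
    obtain ⟨ω₁, hW₁, hc₁⟩ := exists_isArchWeilDatum_slot_of_definite hV ((datum b).r₀ u) ((datum b).s₀ u)
    have h := tendsto_toThetaTop_boostCurveW_sub_div V S hGR η hηc Γ (cmPlacesEquiv (L : Type) b)
      (Equiv.refl _) (Equiv.refl _) (Equiv.refl _) (Equiv.refl _) h₁W hW₁ hc₁ ((datum b).r₀ u) ((datum b).s₀ u)
      (binvPi (MvPolynomial.rename (cmIdx (L : Type) (frameD V) (frameD_real V) (dW S) (dW_real S) ι₁ (cmPlacesEquiv (L : Type) b))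
        (embOf (L : Type) (frameD V) (frameD_real V) (dW S) (dW_real S) ι₁ datum m₁ m₂ b (m b))))
      (rest (L : Type) (frameD V) (frameD_real V) (dW S) (dW_real S) ι₁ datum m₁ m₂ (cmPlacesEquiv (L : Type) b) m) f
    simp only [LinearMap.comp_apply, toThetaTopₗ_apply, Tℓ, R, I, Hx, ρU, curveOf,
      ins_tprod_eq_block (L : Type) (frameD V) (frameD_real V) (frameD_ne V) (dW S) (dW_real S) (dW_ne S) ι₁ datum m₁ m₂ f b m,
      ins_hypX_tprod_eq_block (L : Type) (frameD V) (frameD_real V) (frameD_ne V) (dW S) (dW_real S) (dW_ne S) ι₁ datum m₁ m₂ f b u m]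
    exact h
  -- extend from the pure tensors to every printed vector by linearity (inline `Submodule.span_induction`: the generic
  -- `tendsto_slope_of_span` of #24 cannot be instantiated at `ThetaTop`, whose `Module` instance sits over the type synonym)
  have main : ∀ φ', Tendsto (fun s : ℝ => ((s : ℝ) : ℂ)⁻¹ • ((Tℓ ∘ₗ R s ∘ₗ I) φ' - (Tℓ ∘ₗ I) φ')) (𝓝[≠] 0)
      (𝓝 ((Tℓ ∘ₗ I ∘ₗ Hx) φ')) := by
    intro φ'
    have hmem : φ' ∈ Submodule.span ℂ (Set.range (PiTensorProduct.tprod ℂ)) := by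
      rw [PiTensorProduct.span_tprod_eq_top]; exact Submodule.mem_top
    induction hmem using Submodule.span_induction with
    | mem g hg => exact key g hg
    | zero =>
      simp only [map_zero, sub_zero, smul_zero]
      exact tendsto_const_nhds
    | add x y _ _ hx hy =>
      have h : (fun s : ℝ => ((s : ℝ) : ℂ)⁻¹ • ((Tℓ ∘ₗ R s ∘ₗ I) (x + y) - (Tℓ ∘ₗ I) (x + y))) =
          fun s => ((s : ℝ) : ℂ)⁻¹ • ((Tℓ ∘ₗ R s ∘ₗ I) x - (Tℓ ∘ₗ I) x) +
            ((s : ℝ) : ℂ)⁻¹ • ((Tℓ ∘ₗ R s ∘ₗ I) y - (Tℓ ∘ₗ I) y) := by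
        funext s
        rw [map_add, map_add, ← smul_add]
        congr 1
        abel
      rw [h, map_add]
      exact hx.add hy
    | smul r x _ hx =>
      have h : (fun s : ℝ => ((s : ℝ) : ℂ)⁻¹ • ((Tℓ ∘ₗ R s ∘ₗ I) (r • x) - (Tℓ ∘ₗ I) (r • x))) =
          fun s => r • (((s : ℝ) : ℂ)⁻¹ • ((Tℓ ∘ₗ R s ∘ₗ I) x - (Tℓ ∘ₗ I) x)) := by
        funext s
        rw [map_smul, map_smul, ← smul_sub, smul_comm]
      rw [h, map_smul]
      exact hx.const_smul r
  exact main φ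

end WInput

end HodgeCM.Model.HypCensus

end
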